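/-
Copyright (c) 2026. All rights reserved.
Released under Apache 2.0 license as described in the file LICENSE.
Authors: abc-iut cell, seat abc-iut-w5-d116 (gen 6).
-/
import Mathlib.NumberTheory.NumberField.Units.Basic
import Literature.AnabelianGeometry.AbsoluteAnabelian.NumberFieldCyclotomeRigidityProofs
import Literature.AnabelianGeometry.EtaleTheta.Cyclotome
import HarnessLib

/-!
# [AbsTopIII] Cor 5.2 (ii) at the GENUINE global arithmetic data of a number field, II: rigidity of the
# cyclotome `μ_Ẑ(F̄ˣ) = Λ(F̄ˣ)` and `H⁰(U, Ẑ(1)) = 1` (row «COR52II-NF-MODEL», sequel)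

S. Mochizuki, *Topics in absolute anabelian geometry III* [MochizukiAbsTopIII2015], Cor 5.2 (ii) p. 119: the
isomorphism `μ_Ẑ(M⊚_TM) ⥲ μ_Ẑ(Π)` of `Π`-modules is "unique [hence, in particular, … functorial — relative to
`Th⊚_T`]" for `T ∈ {TF, TM}`; Prop 3.3 (i) p. 73: "only determined up to a `{±1}`-multiple if `T = TLG`".

PROOF-ONLY sequel (abc-iut-w5-d116; no definitions, no named facts) of `NumberFieldCyclotomeRigidityProofs.lean`
(`nfUnits_equivariant_eq_id_or_inv`: a `G_F`-equivariant multiplicative automorphism of `F̄ˣ` is `id` or `x ↦ x⁻¹`),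
for the cyclotome `Λ(F̄ˣ) = lim_n μ_n(F̄)` (`EtaleTheta.cyclotome`, print's `μ_Ẑ(M⊚_TM) := Hom(ℚ/ℤ, M⊚_TM)`) of the
GENUINE global arithmetic data `G_F ↷ F̄ˣ` of a number field `F`:

* `nfCyclotome_map_equivariant_eq_id_or_inv` — the automorphism `Λ(β)` of `μ_Ẑ(F̄ˣ)` induced by a
  `G_F`-equivariant automorphism `β` of `F̄ˣ` (an automorphism of the global `TLG`-type data over the identity of
  `G_F`) is `±1`: exactly the `{±1}`-indeterminacy of Prop 3.3 (i) for `T = TLG`, which Cor 5.2 (ii) excludes.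
* `nfAlgClosure_ringEquiv_equivariant_eq_refl`, `nfCyclotome_map_ringEquiv_equivariant_eq_id` — for the
  `TF`-type data `G_F ↷ F̄` (field structure): a `G_F`-equivariant RING automorphism of `F̄` is the identity, and
  induces the IDENTITY on the cyclotome — at the genuine global `TF`-data the cyclotome isomorphism of
  Cor 5.2 (ii) is RIGID under every automorphism of the pair over `id_Π` ("unique, hence functorial").
* `nf_pow_torsionOrder_eq_one`, `nfCyclotome_eq_one_of_forall_smul_eq` — `H⁰(U, Ẑ(1)) = 1` for every
  subgroup `U ≤ G_F` of finite index (a number field has finitely many roots of unity, Mathlib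
  `NumberField.Units.torsion`; closure of `U` open, Krull fixed field a number field): the `Π`-module
  `μ_Ẑ(Π)` has no non-trivial invariants — the companion of the infinitude / openness of the image of the
  cyclotomic character (tree `GaloisRep.cyclotomicCharacter_range_infinite`, `AbsTopIII.Rmk_1_5_1_holds`;
  `p`-adic twin `EtaleTheta.cyclotome_algClosure_eq_one_of_finiteIndex`).
* (v2) `nfAlgClosure_equivariant_ringEquiv_unique`, `nfUnits_equivariant_mulEquiv_unique_up_to_inv` — Cor 5.2 (iii)
  second half («the reference isomorphisms `ψ⊚` … are uniquely determined») at the genuine global data: two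
  `G_F`-equivariant ring isomorphisms `F̄ ≃+* M` coincide (`TF`); two `G_F`-equivariant group isomorphisms
  `F̄ˣ ≃* A` coincide up to `x ↦ x⁻¹` (`TLG`, Prop 3.3 (i)(ii)).

HONEST SCOPE («NF instance of the schema; genuine `(W_F, C_F)` context not constructed»): model/instance level for
the arithmetic SHADOW `Π = G_F`; for `T = TM` the rigidity of the global pair comes from the LOCAL monoids
`𝒪^▷_{F̄_v}` (inversion does not preserve them; tree `MLFClosure.submonoid_equivariant_eq_self`), not re-proved
here.  Classical; nothing here bears on [IUTchIII] Cor. 3.12 or takes a side.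
-/

noncomputable section

open scoped Classical

namespace Literature.AnabelianGeometry.AbsoluteAnabelian

open Field NumberField
open Literature.AnabelianGeometry.EtaleTheta (cyclotome)

universe u

variable (F : Type u) [Field F]

/-! ### Corollaries for the cyclotome `μ_Ẑ(F̄ˣ) = Λ(F̄ˣ)` -/

/-- **Cor 5.2 (ii) at the genuine global `TLG`-type data, rigidity up to sign.**  The automorphism `Λ(β)` of the
cyclotome `μ_Ẑ(F̄ˣ) = Λ(F̄ˣ)` (`EtaleTheta.cyclotome.map`) induced by a `G_F`-equivariant multiplicative
automorphism `β` of `F̄ˣ` — an automorphism of the pair `G_F ↷ F̄ˣ` over the identity of `G_F` — is the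
identity or the inversion: exactly the `{±1}`-indeterminacy of [AbsTopIII] Prop 3.3 (i) for `T = TLG`, the
case Cor 5.2 (ii) EXCLUDES. [cite: MochizukiAbsTopIII2015, Cor 5.2 (ii) p.119] -/
theorem nfCyclotome_map_equivariant_eq_id_or_inv [NumberField F]
    (β : (AlgebraicClosure F)ˣ ≃* (AlgebraicClosure F)ˣ)
    (hβ : ∀ (σ : absoluteGaloisGroup F) (x : (AlgebraicClosure F)ˣ), β (σ • x) = σ • β x) :
    (∀ ζ : cyclotome (AlgebraicClosure F)ˣ, cyclotome.map β.toMonoidHom ζ = ζ) ∨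
    (∀ ζ : cyclotome (AlgebraicClosure F)ˣ, cyclotome.map β.toMonoidHom ζ = ζ⁻¹) := by
  rcases nfUnits_equivariant_eq_id_or_inv F β hβ with h | h
  · left
    intro ζ
    apply Subtype.ext
    funext n
    rw [cyclotome.map_apply]
    exact h _
  · right
    intro ζ
    apply Subtype.ext
    funext n
    rw [cyclotome.map_apply, Subgroup.coe_inv, Pi.inv_apply]
    exact h _

/-- **The `TF` case: a `G_F`-equivariant RING automorphism of `F̄` is the identity.**  Its restriction to `F̄ˣ`
is an equivariant multiplicative automorphism, hence `id` or `x ↦ x⁻¹`; additivity excludes the inversion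
(`β 2 = 2 ≠ 2⁻¹` in characteristic `0`). [cite: MochizukiAbsTopIII2015, Cor 5.2 (ii) p.119] -/
theorem nfAlgClosure_ringEquiv_equivariant_eq_refl [NumberField F]
    (β : AlgebraicClosure F ≃+* AlgebraicClosure F)
    (hβ : ∀ (σ : absoluteGaloisGroup F) (x : AlgebraicClosure F), β (σ • x) = σ • β x) :
    β = RingEquiv.refl (AlgebraicClosure F) := by
  haveI : CharZero (AlgebraicClosure F) :=
    charZero_of_injective_algebraMap (algebraMap F (AlgebraicClosure F)).injective
  set K := AlgebraicClosure F with hKdef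
  set βu : Kˣ ≃* Kˣ := Units.mapEquiv β.toMulEquiv with hβu
  have hβu_apply : ∀ x : Kˣ, ((βu x : Kˣ) : K) = β (x : K) := fun x => rfl
  have hβuσ : ∀ (σ : absoluteGaloisGroup F) (x : Kˣ), βu (σ • x) = σ • βu x := by
    intro σ x
    apply Units.ext
    rw [hβu_apply, nfUnits_coe_smul, nfUnits_coe_smul, ← absoluteGaloisGroup.smul_def,
      ← absoluteGaloisGroup.smul_def, hβ, hβu_apply]
  have hid : ∀ x : Kˣ, βu x = x := by
    rcases nfUnits_equivariant_eq_id_or_inv F βu hβuσ with h | h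
    · exact h
    · exfalso
      -- inversion is not additive: `β 2 = 2` but `2⁻¹ ≠ 2`
      have h2 : (2 : K) ≠ 0 := two_ne_zero
      have htwo := congrArg (fun u : Kˣ => (u : K)) (h (Units.mk0 (2 : K) h2))
      simp only [hβu_apply, Units.val_mk0, Units.val_inv_eq_inv_val, map_ofNat] at htwo
      have h4 : (2 : K) * 2 = 1 := by
        nth_rewrite 1 [htwo]
        exact inv_mul_cancel₀ h2
      norm_num at h4
  apply RingEquiv.ext
  intro x
  by_cases hx : x = 0
  · rw [hx, map_zero]; rfl
  · have := congrArg (fun u : Kˣ => (u : K)) (hid (Units.mk0 x hx))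
    rw [hβu_apply, Units.val_mk0] at this
    exact this

/-- **Cor 5.2 (ii) at the genuine global `TF`-type data: the cyclotome isomorphism is rigid.**  The
automorphism of `μ_Ẑ(F̄ˣ) = Λ(F̄ˣ)` induced by a `G_F`-equivariant ring automorphism of `F̄` — an automorphism of
the pair `G_F ↷ F̄` over the identity of `G_F` — is the IDENTITY ("unique, hence functorial", `T ∈ {TF, TM}`).
[cite: MochizukiAbsTopIII2015, Cor 5.2 (ii) p.119] -/
theorem nfCyclotome_map_ringEquiv_equivariant_eq_id [NumberField F]
    (β : AlgebraicClosure F ≃+* AlgebraicClosure F)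
    (hβ : ∀ (σ : absoluteGaloisGroup F) (x : AlgebraicClosure F), β (σ • x) = σ • β x)
    (ζ : cyclotome (AlgebraicClosure F)ˣ) :
    cyclotome.map (Units.map (β : AlgebraicClosure F →* AlgebraicClosure F)) ζ = ζ := by
  have h := nfAlgClosure_ringEquiv_equivariant_eq_refl F β hβ
  apply Subtype.ext
  funext n
  rw [cyclotome.map_apply]
  apply Units.ext
  rw [Units.coe_map]
  change β _ = _
  rw [h]
  rfl

/-! ### No invariants: `H⁰(U, μ_Ẑ(F̄ˣ)) = 1` for `U ≤ G_F` of finite index -/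

/-- In a number field `L` every root of unity is killed by the one exponent `torsionOrder L` (the order of
the finite group of roots of unity of `L`, Mathlib `NumberField.Units.torsion`); the finiteness step of `H⁰(U, Ẑ(1)) = 1`. [cite: MochizukiAbsTopIII2015, Cor 5.2 (ii) p.119] -/
theorem nf_pow_torsionOrder_eq_one (L : Type*) [Field L] [NumberField L] {y : L} {k : ℕ} (hk : 0 < k)
    (hy : y ^ k = 1) : y ^ NumberField.Units.torsionOrder L = 1 := by
  have hint : IsIntegral ℤ y := IsIntegral.of_pow hk (by rw [hy]; exact isIntegral_one)
  set yO : 𝓞 L := ⟨y, hint⟩ with hyO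
  have hyOk : yO ^ k = 1 := by
    apply NumberField.RingOfIntegers.ext
    simp [hyO, hy]
  set u : (𝓞 L)ˣ := Units.ofPowEqOne yO k hyOk hk.ne' with hu
  have hutors : u ∈ NumberField.Units.torsion L := by
    rw [NumberField.Units.torsion, CommGroup.mem_torsion, isOfFinOrder_iff_pow_eq_one]
    exact ⟨k, hk, Units.pow_ofPowEqOne hyOk hk.ne'⟩
  have huroot : u ∈ rootsOfUnity (NumberField.Units.torsionOrder L) (𝓞 L) := by
    rw [NumberField.Units.rootsOfUnity_eq_torsion]; exact hutors
  rw [mem_rootsOfUnity] at huroot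
  have hval : ((u : (𝓞 L)ˣ) : 𝓞 L) = yO := rfl
  have h1 : yO ^ NumberField.Units.torsionOrder L = 1 := by
    rw [← hval, ← Units.val_pow_eq_pow_val, huroot, Units.val_one]
  have h2 := congrArg (fun z : 𝓞 L => (z : L)) h1
  simpa only [hyO, map_pow, NumberField.RingOfIntegers.map_mk, map_one] using h2

/-- **`H⁰(U, Ẑ(1)) = 1` over a number field**: an element of the cyclotome `μ_Ẑ(F̄ˣ) = Λ(F̄ˣ)` fixed by a
subgroup `U ≤ G_F` of FINITE INDEX is trivial — the closure `Ū` is open, its fixed field `L` is a finite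
extension of `F` (Krull), every component `ζ_n` lies in the number field `L`, whose roots of unity are killed by
`w = torsionOrder L`, so `ζ_n = ζ_{nw}^w = 1`.  (The cyclotome as `Π`-module has no invariants: the companion of
the infinitude / openness of the image of the cyclotomic character, tree
`GaloisRep.cyclotomicCharacter_range_infinite`, `AbsTopIII.Rmk_1_5_1_holds`; `p`-adic twin:
`EtaleTheta.cyclotome_algClosure_eq_one_of_finiteIndex`.) [cite: MochizukiAbsTopIII2015, Cor 5.2 (ii) p.119] -/
theorem nfCyclotome_eq_one_of_forall_smul_eq [NumberField F]
    (U : Subgroup (absoluteGaloisGroup F)) [U.FiniteIndex]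
    (ζ : cyclotome (AlgebraicClosure F)ˣ) (hζ : ∀ σ ∈ U, σ • ζ = ζ) : ζ = 1 := by
  haveI : IsGalois F (AlgebraicClosure F) := IsAlgClosure.isGalois F (AlgebraicClosure F)
  set K := AlgebraicClosure F with hKdef
  -- transport `U` to the group of `F`-algebra automorphisms and close it up
  set U' : Subgroup (K ≃ₐ[F] K) :=
    U.map (absoluteGaloisGroup.toAlgEquiv F : absoluteGaloisGroup F →* (K ≃ₐ[F] K)) with hU'
  haveI : U'.FiniteIndex := ⟨by rw [hU', Subgroup.index_map_equiv]; exact Subgroup.FiniteIndex.index_ne_zero⟩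
  set V := U'.topologicalClosure with hVdef
  haveI : V.FiniteIndex := Subgroup.finiteIndex_of_le U'.le_topologicalClosure
  have hV : IsOpen (V : Set (K ≃ₐ[F] K)) := V.isOpen_of_isClosed_of_finiteIndex U'.isClosed_topologicalClosure
  set L : IntermediateField F K := IntermediateField.fixedField V with hLdef
  have hLV : L.fixingSubgroup = V := InfiniteGalois.fixingSubgroup_fixedField ⟨V, V.isClosed_of_isOpen hV⟩
  haveI : FiniteDimensional F L := by
    refine (InfiniteGalois.isOpen_iff_finite L).mp ?_
    change IsOpen (L.fixingSubgroup : Set (K ≃ₐ[F] K))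
    rw [hLV]; exact hV
  haveI : NumberField L := NumberField.of_module_finite F L
  -- every component `ζ_n` is fixed by `U'`, hence by `V`, hence lies in `L`
  have hcomp : ∀ σ ∈ U, ∀ n : ℕ+,
      absoluteGaloisGroup.toAlgEquiv F σ (((ζ : ℕ+ → Kˣ) n : Kˣ) : K) = ((ζ : ℕ+ → Kˣ) n : K) := by
    intro σ hσU n
    have h := congrArg (fun ξ : cyclotome Kˣ => (((ξ : ℕ+ → Kˣ) n : Kˣ) : K)) (hζ σ hσU)
    simpa only [cyclotome.coe_smul, Pi.smul_apply, nfUnits_coe_smul] using h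
  have hmemL : ∀ n : ℕ+, (((ζ : ℕ+ → Kˣ) n : Kˣ) : K) ∈ L := by
    intro n
    set z : K := (((ζ : ℕ+ → Kˣ) n : Kˣ) : K) with hz
    haveI : FiniteDimensional F (IntermediateField.adjoin F {z}) :=
      IntermediateField.adjoin.finiteDimensional (Algebra.IsIntegral.isIntegral z)
    have hle : U' ≤ (IntermediateField.adjoin F {z}).fixingSubgroup := by
      rw [← IntermediateField.le_iff_le, IntermediateField.adjoin_le_iff, Set.singleton_subset_iff,
        SetLike.mem_coe, IntermediateField.mem_fixedField_iff]
      intro τ hτ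
      obtain ⟨σ, hσU, rfl⟩ := Subgroup.mem_map.mp hτ
      exact hcomp σ hσU n
    have hVle : V ≤ (IntermediateField.adjoin F {z}).fixingSubgroup :=
      U'.topologicalClosure_minimal hle (IntermediateField.fixingSubgroup_isClosed _)
    rw [hLdef, IntermediateField.mem_fixedField_iff]
    intro τ hτ
    exact (IntermediateField.mem_fixingSubgroup_iff _ _).mp (hVle hτ) z
      (IntermediateField.mem_adjoin_simple_self F z)
  -- the uniform exponent of `L` kills every component: `ζ_n = ζ_{n w}^w = 1`
  set w : ℕ := NumberField.Units.torsionOrder L with hw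
  have hwpos : 0 < w := NumberField.Units.torsionOrder_pos L
  set wP : ℕ+ := ⟨w, hwpos⟩ with hwP
  apply Subtype.ext
  funext n
  apply Units.ext
  have hcompat := cyclotome.pow_apply_mul ζ n wP
  have hroot : (((ζ : ℕ+ → Kˣ) (n * wP) : Kˣ) : K) ^ ((n * wP : ℕ+) : ℕ) = 1 := by
    rw [← Units.val_pow_eq_pow_val, cyclotome.pow_eq_one, Units.val_one]
  have hkill : (⟨_, hmemL (n * wP)⟩ : L) ^ w = 1 :=
    nf_pow_torsionOrder_eq_one L (n * wP).pos (Subtype.ext (by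
      rw [SubmonoidClass.coe_pow]; exact hroot))
  have hkill' : (((ζ : ℕ+ → Kˣ) (n * wP) : Kˣ) : K) ^ w = 1 := by
    have := congrArg (fun y : L => (y : K)) hkill
    simpa only [SubmonoidClass.coe_pow, OneMemClass.coe_one] using this
  rw [← hcompat, Units.val_pow_eq_pow_val]
  change (((ζ : ℕ+ → Kˣ) (n * wP) : Kˣ) : K) ^ w = ((1 : cyclotome Kˣ) : ℕ+ → Kˣ) n
  rw [hkill']
  rfl


/-! ### Cor 5.2 (iii), second half, at the genuine global data: reference isomorphisms are unique -/

/-- **[AbsTopIII] Cor 5.2 (iii), second half («the reference isomorphisms `ψ⊚` … are uniquely determined»), at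
the GENUINE global `TF`-data of a number field**: for any field `M` on which `G_F` acts by ring automorphisms,
two `G_F`-equivariant ring isomorphisms `F̄ ≃+* M` COINCIDE (their quotient is a `G_F`-equivariant ring
automorphism of `F̄`, hence the identity by `nfAlgClosure_ringEquiv_equivariant_eq_refl`).
[cite: MochizukiAbsTopIII2015, Cor 5.2 (iii) p.119] -/
theorem nfAlgClosure_equivariant_ringEquiv_unique [NumberField F] {M : Type*} [Field M]
    [MulSemiringAction (absoluteGaloisGroup F) M] (e₁ e₂ : AlgebraicClosure F ≃+* M)
    (h₁ : ∀ (σ : absoluteGaloisGroup F) (x : AlgebraicClosure F), e₁ (σ • x) = σ • e₁ x)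
    (h₂ : ∀ (σ : absoluteGaloisGroup F) (x : AlgebraicClosure F), e₂ (σ • x) = σ • e₂ x) :
    e₁ = e₂ := by
  have hβ : ∀ (σ : absoluteGaloisGroup F) (x : AlgebraicClosure F),
      (e₁.trans e₂.symm) (σ • x) = σ • (e₁.trans e₂.symm) x := by
    intro σ x
    rw [RingEquiv.trans_apply, RingEquiv.trans_apply, h₁]
    apply e₂.injective
    rw [RingEquiv.apply_symm_apply, h₂, RingEquiv.apply_symm_apply]
  have h := nfAlgClosure_ringEquiv_equivariant_eq_refl F (e₁.trans e₂.symm) hβ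
  apply RingEquiv.ext
  intro x
  have hx := RingEquiv.congr_fun h x
  rw [RingEquiv.trans_apply, RingEquiv.refl_apply] at hx
  -- hx : e₂.symm (e₁ x) = x
  have := congrArg e₂ hx
  rwa [RingEquiv.apply_symm_apply] at this

/-- **[AbsTopIII] Cor 5.2 (iii), second half, at the GENUINE global `TLG`-type data `G_F ↷ F̄ˣ`**: for any
commutative group `A` with a `G_F`-action by automorphisms, two `G_F`-equivariant multiplicative isomorphisms
`F̄ˣ ≃* A` coincide UP TO THE SIGN `x ↦ x⁻¹` — the `{±1}`-indeterminacy of [AbsTopIII] Prop 3.3 (i)(ii) for `TLG`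
(their quotient is a `G_F`-equivariant automorphism of `F̄ˣ`, hence `id` or inversion by
`nfUnits_equivariant_eq_id_or_inv`). [cite: MochizukiAbsTopIII2015, Cor 5.2 (iii) p.119] -/
theorem nfUnits_equivariant_mulEquiv_unique_up_to_inv [NumberField F] {A : Type*} [CommGroup A]
    [MulDistribMulAction (absoluteGaloisGroup F) A]
    (e₁ e₂ : (AlgebraicClosure F)ˣ ≃* A)
    (h₁ : ∀ (σ : absoluteGaloisGroup F) (x : (AlgebraicClosure F)ˣ), e₁ (σ • x) = σ • e₁ x)
    (h₂ : ∀ (σ : absoluteGaloisGroup F) (x : (AlgebraicClosure F)ˣ), e₂ (σ • x) = σ • e₂ x) :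
    (∀ x, e₁ x = e₂ x) ∨ (∀ x, e₁ x = (e₂ x)⁻¹) := by
  have hβ : ∀ (σ : absoluteGaloisGroup F) (x : (AlgebraicClosure F)ˣ),
      (e₁.trans e₂.symm) (σ • x) = σ • (e₁.trans e₂.symm) x := by
    intro σ x
    rw [MulEquiv.trans_apply, MulEquiv.trans_apply, h₁]
    apply e₂.injective
    rw [MulEquiv.apply_symm_apply, h₂, MulEquiv.apply_symm_apply]
  rcases nfUnits_equivariant_eq_id_or_inv F (e₁.trans e₂.symm) hβ with h | h
  · left
    intro x
    have hx := h x
    rw [MulEquiv.trans_apply] at hx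
    have := congrArg e₂ hx
    rwa [MulEquiv.apply_symm_apply] at this
  · right
    intro x
    have hx := h x
    rw [MulEquiv.trans_apply] at hx
    have := congrArg e₂ hx
    rwa [MulEquiv.apply_symm_apply, map_inv] at this

end Literature.AnabelianGeometry.AbsoluteAnabelian

end
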